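import Mathlib
import HarnessLib
import HarnessLib.Audit.Tags
/-!
# HodgeLocusCensusSchema — statement schema for the Hodge-locus census at the Fermat point (cell pub-hlocus, referee gen 3; gen 7: CharZero fix + provable shape lemmas)
HONEST FRAMING: certified instances and evidence bearing on the general Hodge conjecture; no claim.

Sources: Movasati arXiv:1602.06607 Def. 1, Thm. 6 (T_0 V_δ = ker [p_{i+j}]); Movasati–Villaflor arXiv:1705.00084 Thm. 1 (periods of linear cycles).
Conventions: ζ = ζ_{2d}; linear cycle P_{a,b}: x_{b 2e} - ζ^{1+2 a_{2e+1}} x_{b (2e+1)} = 0; exponent reading (i_{b 2e}+1)(1+2a_{2e+1}) (REFEREE.md R2).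
This file types the FINITE linear-algebra certificate the census produces (rank of the explicit period matrix over ℚ(ζ_{2d}));
the geometric identification with T_0 V_δ is the cited Thm. 6 and is NOT claimed here.
-/
namespace Summit.HodgeConjecture.HodgeConjecture.HodgeLocus.Census

/-- the index set I_N = { i ∈ ℤ^{n+2} : 0 ≤ i_e ≤ d-2, Σ i_e = N } as a Finset of functions `Fin (n+2) → ℕ` -/
def indexSet (n d N : ℕ) : Finset (Fin (n+2) → ℕ) :=
  (Fintype.piFinset fun _ : Fin (n+2) => Finset.range (d-1)).filter fun i => ∑ e, i e = N

/-- a linear cycle P_{a,b} of X^d_n: `b` a permutation of the n+2 coordinates, `a e` the twist of pair e (only odd positions matter). -/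
structure LinearCycle (n : ℕ) where
  a : Fin (n+2) → ℕ
  b : Equiv.Perm (Fin (n+2))

/-- the normalised period p_i(P_{a,b}) in the cyclotomic field K ∋ ζ (a primitive 2d-th root of unity), MV18 Thm. 1 with the
common constant (-1)^{n/2}/(d^{n/2+1}(n/2)!) dropped: sign(b)·ζ^{Σ_e (i_{b 2e}+1)(1+2a_{2e+1})} if i_{b 2e}+i_{b (2e+1)} = d-2 ∀e, else 0. -/
noncomputable def period {K : Type*} [Field K] (n d : ℕ) (ζ : K) (P : LinearCycle n) (i : Fin (n+2) → ℕ) : K :=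
  if ∀ e : Fin (n/2+1), i (P.b ⟨2*e, by omega⟩) + i (P.b ⟨2*e+1, by omega⟩) = d-2 then
    (Equiv.Perm.sign P.b : ℤ) *
      ζ ^ (∑ e : Fin (n/2+1), (i (P.b ⟨2*e, by omega⟩) + 1) * (1 + 2 * P.a ⟨2*e+1, by omega⟩))
  else 0

/-- the period of a rational combination δ = Σ c_k [P_k] -/
noncomputable def periodComb {K : Type*} [Field K] (n d : ℕ) (ζ : K) (δ : List (ℚ × LinearCycle n)) (i : Fin (n+2) → ℕ) : K :=
  (δ.map fun ⟨c, P⟩ => (c : K) * period n d ζ P i).sum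

/-- Movasati's matrix [p_{i+j}(δ)], rows i ∈ I_{(n/2)d-n-2}, columns j ∈ I_d -/
noncomputable def ivhsMatrix {K : Type*} [Field K] (n d : ℕ) (ζ : K) (δ : List (ℚ × LinearCycle n)) :
    Matrix (indexSet n d ((n/2)*d - n - 2)) (indexSet n d d) K :=
  fun i j => periodComb n d ζ δ (fun e => i.1 e + j.1 e)

/-- CENSUS CERTIFICATE (statement kind: per-row): the period matrix of δ on X^d_n has rank r over ℚ(ζ_{2d}). By Movasati Thm. 6 (cited, not
formalised) r = codim T_0 V_δ. Instances are to be closed by kernel computation / `decide`-style certificates (two engines first).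
REFEREE gen 7 (R16): the quantifier is over CHARACTERISTIC-ZERO fields only — the matrix has entries in ℤ[ζ_{2d}] and its rank over a
positive-characteristic field with a primitive 2d-th root may DROP at finitely many primes, so the unrestricted `∀ K` of gen 3 was too strong. -/
def IvhsRankEq (n d r : ℕ) (δ : List (ℚ × LinearCycle n)) : Prop :=
  ∀ (K : Type) [Field K] [CharZero K] (ζ : K), IsPrimitiveRoot ζ (2*d) → (ivhsMatrix n d ζ δ).rank = r

/-- EXPLAINED-SMOOTH row shape: the rank equals the (Koszul) codimension `c` of a named known locus L through Fermat along which δ stays Hodge;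
the inclusion L ⊆ V_δ and the identification of c are the cited evidence of the row (COMPONENTS.md), not part of this Prop. -/
def ExplainedSmoothRow (n d c : ℕ) (δ : List (ℚ × LinearCycle n)) : Prop := IvhsRankEq n d c δ

/-- the standard linear cycle P (a = 0, b = id) -/
def standardP (n : ℕ) : LinearCycle n := ⟨fun _ => 0, 1⟩
/-- P_c with P ∩ P_c = P^m: twist t on the odd positions of the last n/2 − m pairs, b = id -/
def standardPc (n m : ℕ) (t : ℕ) : LinearCycle n := ⟨fun e => if e.1 % 2 = 1 ∧ (e.1 / 2) ≥ m + 1 then t else 0, 1⟩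

/-- Movasati §6 five-tuple (4,4,0 | 11, 12): rank 11 for δ = [P] + [P_c], P ∩ P_c = P^0 (two engines: A exact, R mod p; REFEREE R1). OPEN in Lean. -/
@[conjecture] def fiveTuple_4_4_0 : Prop := IvhsRankEq 4 4 11 [(1, standardP 4), (1, standardPc 4 0 1)]
/-- (6,4,1 | 36, 37): rank 36 (excess 1 over intdim = 37; engines A/B/R). Gen 7 status: TANGENT-LEVEL EXPLAINED by the Kloosterman
CI(2,2,1,1) degeneration (T-K1/T-K2/T-K3 pass, engine R mod p ×2 and engine B exact; COMPONENTS.md / LIT-ANSWERS Q4-quinquies); the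
dimension certificate of the explaining family is pending, so the row is 'candidate EXPLAINED-SMOOTH'. Only the rank is typed. -/
@[conjecture] def fiveTuple_6_4_1 : Prop := IvhsRankEq 6 4 36 [(1, standardP 6), (1, standardPc 6 1 1)]

/-! ## Referee instances (REFEREE.md R6/R7, cross-engine certified R9): tangent-exact explained rows at the Fermat quartic fourfold.
Every number below is reproduced by ≥ 2 independent implementations (engine A: MV18 period formula, exact ℚ(ζ₈) + 2 primes;
engine B: Villaflor det-Jac in the Jacobian ring, exact ℚ(ζ₈) + 2 primes; engine R: independent mod-p, 2 primes);
the tangent-space inclusions are exact over ℚ(ζ₈) (engine B) and mod p (engine R); the det-Jac class identities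
P_CI(1,2,2) = Σ₄ plane classes and P_CI(1,1,2) = P + P' hold exactly (data/ivhs/4_4/R6-R7-cross-engine-AB.json). -/

/-- the plane P(a₁,a₃,a₅) := {x₀ = ζ^{1+2a₁} x₁, x₂ = ζ^{1+2a₃} x₃, x₄ = ζ^{1+2a₅} x₅} of X⁴₄, b = id (common orientation). -/
def plane44 (a1 a3 a5 : ℕ) : LinearCycle 4 := ⟨![0, a1, 0, a3, 0, a5], 1⟩

/-- R6: δ_S = [S₀], S₀ = {x₀−ζx₁ = x₂²+ix₃² = x₄²+ix₅² = 0} = P(0,1,1)+P(0,1,3)+P(0,3,1)+P(0,3,3) (a degenerate CI of type (2,2,1)):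
rank 11 = codim of the CI(2,2,1)-locus, whose first-order deformation space at Fermat equals the kernel (COMPONENTS.md row 1, EXPLAINED-SMOOTH:
engines A/B/R, inclusion T_CI = ker exact over ℚ(ζ₈); generic codim 11 two routes). OPEN in Lean (the Prop, not the evidence, is open). -/
@[conjecture] def explainedSmooth_4_4_CI221 : Prop :=
  ExplainedSmoothRow 4 4 11 [(1, plane44 0 1 1), (1, plane44 0 1 3), (1, plane44 0 3 1), (1, plane44 0 3 3)]

/-- R7: [P(0,1,1)] + [P(0,1,3)] (two planes meeting in a line = degenerate quadric surface {x₀−ζx₁ = x₂−ζ³x₃ = x₄²+ix₅² = 0}):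
rank 8 = codim of the (1,1,2)-CI locus (Movasati arXiv:2211.11405 Thm 5; Dan 2014), tangent-exact at Fermat (COMPONENTS.md row 2,
EXPLAINED-SMOOTH: engines A/B/R, T_Q = ker exact; certifies the printed statement at the Fermat point). OPEN in Lean. -/
@[conjecture] def explainedSmooth_4_4_1_quadric : Prop :=
  ExplainedSmoothRow 4 4 8 [(1, plane44 0 1 1), (1, plane44 0 1 3)]

/-- R7: the difference class [P(0,1,1)] − [P(0,1,3)]: rank 8 while the known reduced locus V(Π₁,Π₂) has codim 11 (three ways) — first-order excess 3 confirmed exact; OPEN INSTANCE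
(COMPONENTS.md row 3; order-N certificate pending). Only the rank statement is typed. -/
@[conjecture] def openInstance_4_4_1_difference : Prop :=
  IvhsRankEq 4 4 8 [(1, plane44 0 1 1), (-1, plane44 0 1 3)]

/-- (4,4,0), δ = [P] − [P_c] (two planes meeting in a point, λ = −1; Movasati's 'mysterious' case): rank 11 = dim T_0 V_δ − codim, while
NL(P,P_c) has codim 12. EXPLAINED-SMOOTH (REFEREE R12, certificate K1–K5; engine-B exact T-K1..3 countersign R15(6)): V_δ is the smooth
codim-11 closure of {X ⊃ a (1,2,2)-complete intersection Y_s} with flat limit Y_0 = P ∪ three planes at Fermat, [Y_0]_prim = [P] − [P_c]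
(Kloosterman arXiv:2312.12363 Prop 6.1; ring identities kernel-checked in Literature/AlgebraicGeometry/Kloosterman2025/QuarticTwoPlanesDegeneration).
Only the rank statement is typed; the geometric identification is the cited evidence. -/
@[conjecture] def explainedSmooth_4_4_0_difference : Prop :=
  ExplainedSmoothRow 4 4 11 [(1, standardP 4), (-1, standardPc 4 0 1)]

/-! ## Shape lemmas (PROVED): the sizes of Movasati's matrix for (n,d) = (4,4) and the trivial rank ceiling of every census row. -/

/-- rows of the (4,4) matrix: |I_2| = 21 (Movasati 1602.06607 §6 table sizes; engine A/B/R matrix shape 21 × 90). -/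
theorem card_indexSet_4_4_rows : (indexSet 4 4 2).card = 21 := by decide

/-- columns of the (4,4) matrix: |I_4| = 90 = dim T (the tangent space of the Fermat quartic fourfold's moduli chart). -/
theorem card_indexSet_4_4_cols : (indexSet 4 4 4).card = 90 := by decide

/-- every certified rank is at most the number of columns |I_d| (no census row can claim more equations than parameters); the
witness field is ℂ with ζ = exp(2πi/2d). -/
theorem IvhsRankEq.le_card_cols {n d r : ℕ} (hd : d ≠ 0) (δ : List (ℚ × LinearCycle n)) (h : IvhsRankEq n d r δ) :
    r ≤ (indexSet n d d).card := by
  have hζ : IsPrimitiveRoot (Complex.exp (2 * Real.pi * Complex.I / ((2*d : ℕ) : ℂ))) (2*d) :=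
    Complex.isPrimitiveRoot_exp (2*d) (by omega)
  have := h ℂ _ hζ
  rw [← this]
  simpa [Fintype.card_coe] using (ivhsMatrix n d (Complex.exp (2 * Real.pi * Complex.I / ((2*d : ℕ) : ℂ))) δ).rank_le_card_width

end Summit.HodgeConjecture.HodgeConjecture.HodgeLocus.Census
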